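import Literature.AlgebraicGeometry.AbelianSchemes.AbelianSchemeQuotientMulNDescent
import HarnessLib

/-!
# A `K`-invariant homomorphism descends along the quotient `ψ : A → A/K` (HECKE-LINK H2c-core)

Layer `Literature/AlgebraicGeometry/AbelianSchemes`, namespace `Literature.AlgebraicGeometry.AbelianSchemes.AbelianSchemeOver`.
Cell `hodgecm-mathlib`, HECKE-LINK line card v1.2 §1, over ★ file (i) `AbelianSchemeConstSubgroupQuotient` (p742166: `ψ = quotientMk`,
`A/K = quotientBy`, the glued quotient and ★ `gluedDesc`) and ★ D0 `AbelianSchemeQuotientMulNDescent` (p742656: `ψ`, `ψ ⊗ₘ ψ`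
are epimorphisms) — D0 GENERALISED from `[n]` to an arbitrary `K`-invariant morphism.  [MumfordAV1970] §7 Thm. 4 (p. 72)
(universal property of the quotient by a finite subgroup: a homomorphism killing `K` factors uniquely through `A → A/K`);
[MumfordFogartyKirwan1994] Ch. 7 §1 Prop. 7.1.  For an abelian scheme `A → S`, `u : S ⟶ Y` (`Y` affine for the homomorphism
clause), a finite constant subgroup `K ⊆ A(S)` with a `K`-stable affine cover, and an `S`-morphism `φ : A → C` INVARIANT under
the translations `t_σ`, `σ ∈ K` (`C.left` separated):
* `homDesc φ hφ hcov : A/K → C` (DEFINITION: underlying map ★ `gluedDesc`), `quotientMk_comp_homDesc : ψ ≫ homDesc = φ`,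
  `homDesc_unique` (after the epi `ψ`);
* `isMonHom_homDesc`: if `C` is a group object and `φ` a HOMOMORPHISM, so is `homDesc φ` for the descended group law of `A/K`
  (`η`/`μ` clauses after cancelling `ψ`, `ψ ⊗ₘ ψ`);
* `homDesc_mulN : homDesc [n] = mulNDesc` (bridge to ★ D0);
* the POLARISATION case `polarizationDesc`: for a dual-side quotient `ψ̂ : Â → Â/K′` and a homomorphism `lam : A → Â` with
  `lam ≫ ψ̂` `K`-invariant («`λ(K) ⊆ K′`»), `λ_B := homDesc (lam ≫ ψ̂) : A/K → Â/K′` with `ψ ≫ λ_B = lam ≫ ψ̂`, a homomorphism —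
  the `λ_B` of the Hecke-link's identity «`ψ ≫ λ_B ≫ ψ^∨ = λ ≫ [ν]`» (H2c, B-p14 (g14)).
Definitions with bodies + theorems; no `Prop`-valued def, no instance, no sorry.  HC_CM is proved only modulo the 7 printed
citations until rung 0 closes; nothing here is about HC.

## References
* [MumfordAV1970] D. Mumford, *Abelian Varieties* (1970), §7 Thm. 4 (p. 72); §23 (p. 231).
* [MumfordFogartyKirwan1994] D. Mumford, J. Fogarty, F. Kirwan, *GIT*, Ch. 7 §1 Prop. 7.1 (p. 127).
-/

noncomputable section

universe u

open CategoryTheory CategoryTheory.Limits AlgebraicGeometry MonoidalCategory CartesianMonoidalCategory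
open scoped MonObj

namespace Literature.AlgebraicGeometry.AbelianSchemes

namespace AbelianSchemeOver

open Literature.AlgebraicGeometry.RelativeSpec

variable {S : Scheme.{u}} (A : AbelianSchemeOver S)
  {Y : Scheme.{u}} (u : S ⟶ Y) (K : Subgroup A.Sections) [Finite K] [Y.IsSeparated] [IsSeparated (A.X.hom ≫ u)]
  [S.IsSeparated] (hcov : ∀ x : A.left, ∃ O : (A.translationActionOver u K).StableAffineOpens, x ∈ O.1)
  {C : Over S} [C.left.IsSeparated] (φ : A.X ⟶ C) (hφ : ∀ σ : K, A.translation (σ : A.Sections) ≫ φ = φ)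

/-! ## §1 Descent of a `K`-invariant morphism -/

omit [Finite K] [Y.IsSeparated] [IsSeparated (A.X.hom ≫ u)] [S.IsSeparated] [C.left.IsSeparated] in
include hφ in
/-- `φ.left` is invariant under the translation action. [cite: MumfordAV1970, §7 Thm. 4 (p. 72)] -/
theorem aut_hom_comp_left_of_invariant (σ : K) :
    ((A.translationActionOver u K).aut σ).hom ≫ φ.left = φ.left := by
  rw [translationActionOver_aut_hom, ← Over.comp_left, hφ σ]

/-- **`homDesc φ : A/K → C`, the descent of the `K`-invariant `S`-morphism `φ` along `ψ`** (underlying map ★ `gluedDesc`).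
[cite: MumfordAV1970, §7 Thm. 4 (p. 72)] [cite: MumfordFogartyKirwan1994, Ch. 7 §1 Prop. 7.1 (p. 127)] -/
def homDesc : A.quotientOver u K ⟶ C :=
  Over.homMk ((A.translationActionOver u K).gluedDesc φ.left (A.aut_hom_comp_left_of_invariant u K φ hφ)) (by
    show _ = (A.translationActionOver u K).gluedDesc A.X.hom (A.aut_hom_comp_hom u K)
    refine (A.translationActionOver u K).glued_hom_ext hcov ?_
    exact ((A.translationActionOver u K).gluedMk_gluedDesc_assoc hcov _ _ _).trans
      ((Over.w φ).trans ((A.translationActionOver u K).gluedMk_gluedDesc hcov _ _).symm))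

/-- **`ψ ≫ homDesc φ = φ`.** [cite: MumfordAV1970, §7 Thm. 4 (p. 72)] -/
@[reassoc (attr := simp)]
theorem quotientMk_comp_homDesc : A.quotientMk u K hcov ≫ A.homDesc u K hcov φ hφ = φ :=
  Over.OverMorphism.ext ((A.translationActionOver u K).gluedMk_gluedDesc hcov _ _)

/-- **Uniqueness of the descent** (after the epimorphism `ψ`; `Y` affine, `K` free on geometric points).
[cite: MumfordAV1970, §7 Thm. 4 (p. 72)] -/
theorem homDesc_unique [IsAffine Y]
    (hfree : ∀ (Ω : Type u) [Field Ω] [IsAlgClosed Ω] (x : Spec (.of Ω) ⟶ A.left) (σ : K), σ ≠ 1 →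
      x ≫ (A.translation (σ : A.Sections)).left ≠ x)
    (g : A.quotientOver u K ⟶ C) (hg : A.quotientMk u K hcov ≫ g = φ) : g = A.homDesc u K hcov φ hφ := by
  haveI := A.epi_quotientMk u K hcov hfree
  rw [← cancel_epi (A.quotientMk u K hcov), hg, quotientMk_comp_homDesc]

/-- Bridge to ★ D0: `mulNDesc = homDesc [n]`. [cite: MumfordAV1970, §7 Thm. 4 (p. 72)] -/
theorem mulNDesc_eq_homDesc [IsCommMonObj A.X] {n : ℕ} (hK : ∀ σ : K, (σ : A.Sections) ^ n = 1) :
    haveI : IsSeparated A.X.hom := IsSeparated.of_comp A.X.hom u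
    haveI : A.left.IsSeparated := A.isSeparated_left_of_base
    A.mulNDesc u K hK hcov =
      A.homDesc u K hcov (A.mulN n) (fun σ => A.translation_comp_mulN _ n (hK σ)) :=
  rfl

/-! ## §2 The descent of a homomorphism is a homomorphism -/

variable [LocallyOfFiniteType (A.X.hom ≫ u)] [IsLocallyNoetherian Y]
  (hG : ∃ _ : GrpObj (A.quotientOver u K), IsMonHom (A.quotientMk u K hcov))
  (hsm : Smooth (A.quotientOver u K).hom) (hgc : GeometricallyConnected (A.quotientOver u K).hom)
  (hfree : ∀ (Ω : Type u) [Field Ω] [IsAlgClosed Ω] (x : Spec (.of Ω) ⟶ A.left) (σ : K), σ ≠ 1 →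
    x ≫ (A.translation (σ : A.Sections)).left ≠ x)

include hfree in
/-- **`homDesc φ` is a homomorphism** for the descended group law of `A/K` when `φ` is (`η` and `μ` clauses checked after the
epimorphisms `ψ`, `ψ ⊗ₘ ψ`, ★ `epi_quotientMk(_tensorHom)`). [cite: MumfordAV1970, §7 Thm. 4 (p. 72)] -/
theorem isMonHom_homDesc [IsAffine Y] [GrpObj C] [IsMonHom φ] :
    letI : GrpObj (A.quotientOver u K) := (A.quotientBy u K hcov hG hsm hgc).grpObj
    IsMonHom (A.homDesc u K hcov φ hφ) := by
  letI : GrpObj (A.quotientOver u K) := (A.quotientBy u K hcov hG hsm hgc).grpObj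
  haveI := A.isMonHom_quotientMk u K hcov hG hsm hgc
  haveI := A.epi_quotientMk_tensorHom u K hcov hfree
  refine ⟨?_, ?_⟩
  · rw [← IsMonHom.one_hom (A.quotientMk u K hcov), Category.assoc, quotientMk_comp_homDesc, IsMonHom.one_hom φ]
  · rw [← cancel_epi (A.quotientMk u K hcov ⊗ₘ A.quotientMk u K hcov), ← Category.assoc,
      ← IsMonHom.mul_hom (A.quotientMk u K hcov), Category.assoc, quotientMk_comp_homDesc, ← Category.assoc,
      tensorHom_comp_tensorHom, quotientMk_comp_homDesc, IsMonHom.mul_hom φ]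

/-! ## §3 The polarisation case: `λ_B : A/K → Â/K′` -/

omit [C.left.IsSeparated] in
/-- **`λ_B := homDesc (λ ≫ ψ̂) : A/K → Â/K′`**, the descent of a homomorphism `λ : A → Â` composed with a dual-side quotient
`ψ̂ : Â → Â/K′`, under the RAW invariance hypothesis `t_σ ≫ λ ≫ ψ̂ = λ ≫ ψ̂` for `σ ∈ K` («`λ(K) ⊆ K′`»).
[cite: MumfordAV1970, §23 (p. 231)] [cite: MumfordAV1970, §7 Thm. 4 (p. 72)] -/
def polarizationDesc (Ah : AbelianSchemeOver S) (K' : Subgroup Ah.Sections) [Finite K'] [IsSeparated (Ah.X.hom ≫ u)]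
    (hcov' : ∀ x : Ah.left, ∃ O : (Ah.translationActionOver u K').StableAffineOpens, x ∈ O.1)
    (lam : A.X ⟶ Ah.X)
    (hlam : ∀ σ : K, A.translation (σ : A.Sections) ≫ lam ≫ Ah.quotientMk u K' hcov' = lam ≫ Ah.quotientMk u K' hcov') :
    A.quotientOver u K ⟶ Ah.quotientOver u K' :=
  haveI := Ah.isSeparated_quotientOver_left u K' hcov'
  A.homDesc u K hcov (lam ≫ Ah.quotientMk u K' hcov') hlam

omit [C.left.IsSeparated] [LocallyOfFiniteType (A.X.hom ≫ u)] [IsLocallyNoetherian Y] in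
/-- **`ψ ≫ λ_B = λ ≫ ψ̂`.** [cite: MumfordAV1970, §23 (p. 231)] -/
theorem quotientMk_comp_polarizationDesc (Ah : AbelianSchemeOver S) (K' : Subgroup Ah.Sections) [Finite K']
    [IsSeparated (Ah.X.hom ≫ u)] (hcov' : ∀ x : Ah.left, ∃ O : (Ah.translationActionOver u K').StableAffineOpens, x ∈ O.1)
    (lam : A.X ⟶ Ah.X)
    (hlam : ∀ σ : K, A.translation (σ : A.Sections) ≫ lam ≫ Ah.quotientMk u K' hcov' = lam ≫ Ah.quotientMk u K' hcov') :
    A.quotientMk u K hcov ≫ A.polarizationDesc u K hcov Ah K' hcov' lam hlam = lam ≫ Ah.quotientMk u K' hcov' :=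
  haveI := Ah.isSeparated_quotientOver_left u K' hcov'
  A.quotientMk_comp_homDesc u K hcov _ hlam

omit [C.left.IsSeparated] in
include hfree in
/-- **`λ_B` is a homomorphism** for the descended group laws of `A/K` and `Â/K′` when `λ` is.
[cite: MumfordAV1970, §23 (p. 231)] [cite: MumfordAV1970, §7 Thm. 4 (p. 72)] -/
theorem isMonHom_polarizationDesc [IsAffine Y] (Ah : AbelianSchemeOver S) (K' : Subgroup Ah.Sections) [Finite K']
    [IsSeparated (Ah.X.hom ≫ u)] (hcov' : ∀ x : Ah.left, ∃ O : (Ah.translationActionOver u K').StableAffineOpens, x ∈ O.1)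
    [LocallyOfFiniteType (Ah.X.hom ≫ u)]
    (hG' : ∃ _ : GrpObj (Ah.quotientOver u K'), IsMonHom (Ah.quotientMk u K' hcov'))
    (hsm' : Smooth (Ah.quotientOver u K').hom) (hgc' : GeometricallyConnected (Ah.quotientOver u K').hom)
    (lam : A.X ⟶ Ah.X) [IsMonHom lam]
    (hlam : ∀ σ : K, A.translation (σ : A.Sections) ≫ lam ≫ Ah.quotientMk u K' hcov' = lam ≫ Ah.quotientMk u K' hcov') :
    letI : GrpObj (A.quotientOver u K) := (A.quotientBy u K hcov hG hsm hgc).grpObj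
    letI : GrpObj (Ah.quotientOver u K') := (Ah.quotientBy u K' hcov' hG' hsm' hgc').grpObj
    IsMonHom (A.polarizationDesc u K hcov Ah K' hcov' lam hlam) := by
  letI : GrpObj (Ah.quotientOver u K') := (Ah.quotientBy u K' hcov' hG' hsm' hgc').grpObj
  haveI := Ah.isMonHom_quotientMk u K' hcov' hG' hsm' hgc'
  haveI := Ah.isSeparated_quotientOver_left u K' hcov'
  exact A.isMonHom_homDesc u K hcov _ hlam hG hsm hgc hfree

end AbelianSchemeOver

end Literature.AlgebraicGeometry.AbelianSchemes

end
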